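import Mathlib
import Summits.ValiantsHypothesis.ValiantsHypothesis.Theses.RefutationDegree
import Summits.ValiantsHypothesis.ValiantsHypothesis.Theses.GCTMult
import Literature.Computability.Complexity.HermitianSosRefutation
import Literature.Computability.Complexity.NullstellensatzRefutation
import Literature.Computability.AlgebraicComplexity.OrbitClosureProofs
import Summits.ValiantsHypothesis.ValiantsHypothesis.Theorems.RefutationDegreeCertWindowQPNsSmall
import Summits.ValiantsHypothesis.ValiantsHypothesis.Theorems.RefutationDegreeCertWindowQPCoeffDegree
import Summits.ValiantsHypothesis.ValiantsHypothesis.Theorems.RefutationDegreeCertWindowQPLojZero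
import Summits.ValiantsHypothesis.ValiantsHypothesis.Theorems.RefutationDegreeCertWindowQPDegArith
import Summits.ValiantsHypothesis.ValiantsHypothesis.Theorems.RefutationDegreeNsToSos

/-!
# Line `Sketch` (idea `skoda-border-sandwich`) for crux `CertWindowQP` (stmt-ValiantsHypothesis-5640)
# — skeleton v2 (lead c1): the ALGEBRAIC transfer (Briançon–Skoda instead of Skoda's `L²` division)

Composition idea unchanged: `GCTMult.GctThesis` (border quasi-polynomial hardness of the padded
permanent, item stmt-ValiantsHypothesis-0323) plus ONE named classical theorem turns border
non-membership into Hermitian-SOS refutations of `Rep(n,m)` of degree `≤ ((n²+1)m²+1)·m ≤ (m+2)^5`,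
whence `RefutationDegree.CertWindowQP` with `c' = 5`. Version 1 of this line (all stubs landed, closing
file at the gate) used the ANALYTIC named fact `skodaBrownawellDegreeBound` (Skoda 1972 + Liouville) via a
Łojasiewicz inequality. Version 2 replaces the analytic half by commutative algebra:

* `GctThesis` gives `X₀₀^{m-n} per_n ∉ Δ[det_m]`; `Δ[det_m]` is a Zariski closure in coefficient space,
  so some polynomial `p` in the coefficients vanishes on `GL·det_m` (hence on `End·det_m ⊆ Δ[det_m]`,
  which contains every homogenised affine pencil `det(X₀₀A₀ + ∑ X_e A_e)`) but not at the padded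
  permanent; pulled back along the (linear, constant-coefficient) homogenisation map it becomes a
  polynomial `q` in variables indexed by the `x`-monomials with `q(coeff per_n) ≠ 0` and
  `q(coeff_• det(A₀ + ∑ x_e A_e)) = 0` IDENTICALLY in the unknown entries `a` (`stub_pullback`);
* the `x`-coefficients `P_μ(a)` of the generic pencil determinant are homogeneous of degree `m` in `a`
  (`stub_coeffHomog`), so a homogeneous component `F` of `q` already does the same (`stub_homogSelect`);
* homogenising the unknowns with one more variable `T` (`G_μ = P_μ - c_μ T^m`, `c_μ = coeff_μ per_n`),
  `Φ(Y,T) := F(Y + c·T)` is a homogeneous relation `Φ(G, T^m) = F(P) = 0` with `Φ(0,1) = F(c) ≠ 0`, i.e.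
  an equation of integral dependence of `T^m` over the ideal `(G_μ)_μ` (`stub_integralRel`);
* the **Briançon–Skoda theorem** for the polynomial ring in `N+1` variables (Lipman–Sathaye;
  Huneke–Swanson Cor. 13.3.4: `\overline{I^{d}} ⊆ I` in a regular ring of dimension `d`) gives
  `T^{m(N+1)} ∈ (G_μ)_μ` (named fact `brianconSkodaPolynomialRing`, stated below, to be vendored under
  `Literature/RingTheory/IntegralClosure/`; stub `stub_brianconSkoda`);
* taking homogeneous components and setting `T = 1` yields a Nullstellensatz refutation of `Rep(n,m)`
  with every product of degree `≤ (N+1)·m` (`stub_nsOfPowMem`), `≤ (m+2)^5` by the landed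
  `stub_degArith`; `m < n` is the landed `stub_nsSmall`; NS ⇒ Hermitian SOS and the route's inlined
  form are in tree (`HasNSRefutationOfDegree.hasHermitianSosRefutationOfDegree`,
  `exists_sos_certificate_support_of_hasHermitianSosRefutationOfDegree_coeff`).

Sorries only in `stub_*`; `CertWindowQP_of` concludes the crux by name.
-/

open scoped BigOperators
open MvPolynomial

namespace Summit.ValiantsHypothesis.ValiantsHypothesis.Theorems

open Literature.Computability.AlgebraicComplexity Literature.Computability.Complexity
open Summit.ValiantsHypothesis.ValiantsHypothesis.Theses

set_option linter.dupNamespace false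

/-- **Briançon–Skoda theorem for polynomial rings (named fact, to be vendored as
`Literature.RingTheory.IntegralClosure.brianconSkodaPolynomialRing`).** `K` a field, `R = K[σ]` the
polynomial ring in `d = #σ ≥ 1` variables, `G : ι → R` any family, `f ∈ R`. If `f` satisfies a
homogeneous relation `Φ(G, f) = 0` — `Φ ∈ K[Y_ι, T]` homogeneous of degree `k` (`T` = the variable
`none`) with `Φ(0, 1) ≠ 0`, i.e. `c·f^k + Φ₁(G) f^{k-1} + ⋯ + Φ_k(G) = 0` with `c ≠ 0` and
`Φ_j(G) ∈ I^j`, `I = (G_i)_i`: an equation of integral dependence of `f` over the ideal `I`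
(Huneke–Swanson Def. 1.1.1) — then `f ^ d ∈ I`: indeed `f ∈ Ī`, so `f^d ∈ Ī^d ⊆ \overline{I^d}`
(H–S Rem. 1.3.2 (4)) `⊆ I` by the Briançon–Skoda theorem of Lipman–Sathaye for the regular ring
`K[σ]` of dimension `d` (H–S Cor. 13.3.4 with `n = 0`). [cite: HunekeSwanson2006, Cor. 13.3.4] -/
def brianconSkodaPolynomialRing : Prop :=
  ∀ (K : Type) [Field K] (σ ι : Type) [Fintype σ] [Nonempty σ]
    (G : ι → MvPolynomial σ K) (f : MvPolynomial σ K) (k : ℕ) (Φ : MvPolynomial (Option ι) K),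
    Φ.IsHomogeneous k →
    MvPolynomial.eval (fun o : Option ι => o.elim 1 fun _ => 0) Φ ≠ 0 →
    MvPolynomial.aeval (fun o : Option ι => o.elim f G) Φ = 0 →
    f ^ Fintype.card σ ∈ Ideal.span (Set.range G)

/-- **Named-fact stub.** The Briançon–Skoda theorem for polynomial rings; NOT expected to be proved
inside the line — it is vendored as the Literature named fact `brianconSkodaPolynomialRing` and stays
a hypothesis of the closing theorem. -/
theorem stub_brianconSkoda : brianconSkodaPolynomialRing := by
  sorry

/-- Every `x`-coefficient of the generic pencil determinant `det (A₀ + ∑ x_e A_e)` (entries: the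
unknowns `a`) is homogeneous of degree `m` in the `(n²+1)m²` unknowns (the determinant is a form
of degree `m` in the entries, and each entry is linear in `a`). -/
theorem stub_coeffHomog (n m : ℕ) (μ : (Fin n × Fin n) →₀ ℕ) :
    (MvPolynomial.coeff μ (Matrix.of fun i j : Fin m => MvPolynomial.C (MvPolynomial.X (none, (i, j))) + ∑ e : Fin n × Fin n, MvPolynomial.X e * MvPolynomial.C (MvPolynomial.X (some e, (i, j))) : Matrix (Fin m) (Fin m) (MvPolynomial (Fin n × Fin n) (MvPolynomial (Option (Fin n × Fin n) × (Fin m × Fin m)) ℂ))).det).IsHomogeneous m := by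
  sorry

/-- **Pullback of a separating equation.** If `n ≤ m` and the padded permanent is off `Δ[det_m]`,
there is a polynomial `q` in variables indexed by the `x`-monomials `μ` which does not vanish at
the coefficient vector of `per_n` but vanishes IDENTICALLY (as a polynomial in the unknowns `a`)
when `Y_μ ↦ coeff_μ det (A₀ + ∑ x_e A_e)`: take `p` vanishing on `GL·det_m` but not at the padded
permanent (`mem_orbitClosure_iff`), pull it back along the constant-coefficient homogenisation map
`H` of `Theorems/RefutationDegreeCertWindowQPLojZero.lean` (`lojZero_coeff_homog`,
`lojZero_homog_perPoly`); `H(det A(a)) ∈ End·det_m ⊆ Δ[det_m]`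
(`lojZero_homog_affDet_mem_endOrbit`, `endOrbit_subset_orbitClosure_holds`) kills it at every
point `a`, hence identically (`MvPolynomial.funext`). -/
theorem stub_pullback (n m : ℕ) [NeZero m] (hnm : n ≤ m)
    (hpad : paddedPerPoly ℂ n m ∉ orbitClosure (detPoly (Fin m) ℂ)) :
    ∃ q : MvPolynomial ((Fin n × Fin n) →₀ ℕ) ℂ,
      MvPolynomial.eval (fun μ : (Fin n × Fin n) →₀ ℕ => MvPolynomial.coeff μ (perPoly (Fin n) ℂ)) q ≠ 0 ∧
      MvPolynomial.aeval (fun μ : (Fin n × Fin n) →₀ ℕ => MvPolynomial.coeff μ (Matrix.of fun i j : Fin m => MvPolynomial.C (MvPolynomial.X (none, (i, j))) + ∑ e : Fin n × Fin n, MvPolynomial.X e * MvPolynomial.C (MvPolynomial.X (some e, (i, j))) : Matrix (Fin m) (Fin m) (MvPolynomial (Fin n × Fin n) (MvPolynomial (Option (Fin n × Fin n) × (Fin m × Fin m)) ℂ))).det) q = 0 := by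
  sorry

/-- **Homogeneous selection.** If the substituted polynomials are all homogeneous of the same degree
`m ≥ 1`, a relation `q(P) = 0` splits into the relations `q_i(P) = 0` of its homogeneous components
(they land in the pairwise distinct degrees `m·i`), and one of them keeps `q_i(c) ≠ 0`. -/
theorem stub_homogSelect (n m : ℕ) [NeZero m] (q : MvPolynomial ((Fin n × Fin n) →₀ ℕ) ℂ)
    (hhom : ∀ μ : (Fin n × Fin n) →₀ ℕ, (MvPolynomial.coeff μ (Matrix.of fun i j : Fin m => MvPolynomial.C (MvPolynomial.X (none, (i, j))) + ∑ e : Fin n × Fin n, MvPolynomial.X e * MvPolynomial.C (MvPolynomial.X (some e, (i, j))) : Matrix (Fin m) (Fin m) (MvPolynomial (Fin n × Fin n) (MvPolynomial (Option (Fin n × Fin n) × (Fin m × Fin m)) ℂ))).det).IsHomogeneous m)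
    (hq0 : MvPolynomial.eval (fun μ : (Fin n × Fin n) →₀ ℕ => MvPolynomial.coeff μ (perPoly (Fin n) ℂ)) q ≠ 0)
    (hqP : MvPolynomial.aeval (fun μ : (Fin n × Fin n) →₀ ℕ => MvPolynomial.coeff μ (Matrix.of fun i j : Fin m => MvPolynomial.C (MvPolynomial.X (none, (i, j))) + ∑ e : Fin n × Fin n, MvPolynomial.X e * MvPolynomial.C (MvPolynomial.X (some e, (i, j))) : Matrix (Fin m) (Fin m) (MvPolynomial (Fin n × Fin n) (MvPolynomial (Option (Fin n × Fin n) × (Fin m × Fin m)) ℂ))).det) q = 0) :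
    ∃ (i : ℕ) (F : MvPolynomial ((Fin n × Fin n) →₀ ℕ) ℂ), F.IsHomogeneous i ∧
      MvPolynomial.eval (fun μ : (Fin n × Fin n) →₀ ℕ => MvPolynomial.coeff μ (perPoly (Fin n) ℂ)) F ≠ 0 ∧
      MvPolynomial.aeval (fun μ : (Fin n × Fin n) →₀ ℕ => MvPolynomial.coeff μ (Matrix.of fun i j : Fin m => MvPolynomial.C (MvPolynomial.X (none, (i, j))) + ∑ e : Fin n × Fin n, MvPolynomial.X e * MvPolynomial.C (MvPolynomial.X (some e, (i, j))) : Matrix (Fin m) (Fin m) (MvPolynomial (Fin n × Fin n) (MvPolynomial (Option (Fin n × Fin n) × (Fin m × Fin m)) ℂ))).det) F = 0 := by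
  sorry

/-- **The integral relation.** Homogenise the unknowns with a fresh variable `T` (= `none`):
`G_μ := P_μ - c_μ T^m` with `c_μ = coeff_μ per_n`. For `F` homogeneous with `F(P) = 0`, the
polynomial `Φ(Y, T) := F(Y + c·T)` is homogeneous of the same degree, `Φ(0,1) = F(c)`, and
`Φ(G, T^m) = F(G + c T^m) = F(P) = 0` — an equation of integral dependence of `T^m` over `(G_μ)_μ`
in the shape consumed by `brianconSkodaPolynomialRing`. -/
theorem stub_integralRel (n m i : ℕ) (F : MvPolynomial ((Fin n × Fin n) →₀ ℕ) ℂ) (hF : F.IsHomogeneous i)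
    (hF0 : MvPolynomial.eval (fun μ : (Fin n × Fin n) →₀ ℕ => MvPolynomial.coeff μ (perPoly (Fin n) ℂ)) F ≠ 0)
    (hFP : MvPolynomial.aeval (fun μ : (Fin n × Fin n) →₀ ℕ => MvPolynomial.coeff μ (Matrix.of fun i j : Fin m => MvPolynomial.C (MvPolynomial.X (none, (i, j))) + ∑ e : Fin n × Fin n, MvPolynomial.X e * MvPolynomial.C (MvPolynomial.X (some e, (i, j))) : Matrix (Fin m) (Fin m) (MvPolynomial (Fin n × Fin n) (MvPolynomial (Option (Fin n × Fin n) × (Fin m × Fin m)) ℂ))).det) F = 0) :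
    ∃ Φ : MvPolynomial (Option ((Fin n × Fin n) →₀ ℕ)) ℂ, Φ.IsHomogeneous i ∧
      MvPolynomial.eval (fun o : Option ((Fin n × Fin n) →₀ ℕ) => o.elim 1 fun _ => 0) Φ ≠ 0 ∧
      MvPolynomial.aeval (fun o : Option ((Fin n × Fin n) →₀ ℕ) => o.elim
        ((MvPolynomial.X none : MvPolynomial (Option (Option (Fin n × Fin n) × (Fin m × Fin m))) ℂ) ^ m)
        fun μ : (Fin n × Fin n) →₀ ℕ => MvPolynomial.rename some (MvPolynomial.coeff μ (Matrix.of fun i j : Fin m => MvPolynomial.C (MvPolynomial.X (none, (i, j))) + ∑ e : Fin n × Fin n, MvPolynomial.X e * MvPolynomial.C (MvPolynomial.X (some e, (i, j))) : Matrix (Fin m) (Fin m) (MvPolynomial (Fin n × Fin n) (MvPolynomial (Option (Fin n × Fin n) × (Fin m × Fin m)) ℂ))).det) - MvPolynomial.C (MvPolynomial.coeff μ (perPoly (Fin n) ℂ)) * MvPolynomial.X none ^ m) Φ = 0 := by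
  sorry

/-- **From ideal membership to a Nullstellensatz refutation of degree `(N+1)·m`.** If
`(T^m)^{N+1} ∈ (G_μ)_μ` (`N+1 = #(unknowns) + 1`, `G_μ = P_μ - c_μ T^m` homogeneous of degree `m`),
then taking the degree-`m(N+1)` homogeneous component of an identity `∑ H_μ G_μ = T^{m(N+1)}`
makes every `H_μ` homogeneous of degree `mN`, and setting `T = 1` (`G_μ ↦ P_μ - c_μ = coeff_μ P`,
degrees do not increase) gives `∑ h_μ · coeff_μ P = 1` with every product of degree `≤ mN + m`. -/
theorem stub_nsOfPowMem (n m : ℕ)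
    (hhom : ∀ μ : (Fin n × Fin n) →₀ ℕ, (MvPolynomial.coeff μ (Matrix.of fun i j : Fin m => MvPolynomial.C (MvPolynomial.X (none, (i, j))) + ∑ e : Fin n × Fin n, MvPolynomial.X e * MvPolynomial.C (MvPolynomial.X (some e, (i, j))) : Matrix (Fin m) (Fin m) (MvPolynomial (Fin n × Fin n) (MvPolynomial (Option (Fin n × Fin n) × (Fin m × Fin m)) ℂ))).det).IsHomogeneous m)
    (hmem : (((MvPolynomial.X none : MvPolynomial (Option (Option (Fin n × Fin n) × (Fin m × Fin m))) ℂ) ^ m) ^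
        Fintype.card (Option (Option (Fin n × Fin n) × (Fin m × Fin m)))) ∈
      Ideal.span (Set.range fun μ : (Fin n × Fin n) →₀ ℕ => MvPolynomial.rename some (MvPolynomial.coeff μ (Matrix.of fun i j : Fin m => MvPolynomial.C (MvPolynomial.X (none, (i, j))) + ∑ e : Fin n × Fin n, MvPolynomial.X e * MvPolynomial.C (MvPolynomial.X (some e, (i, j))) : Matrix (Fin m) (Fin m) (MvPolynomial (Fin n × Fin n) (MvPolynomial (Option (Fin n × Fin n) × (Fin m × Fin m)) ℂ))).det) - MvPolynomial.C (MvPolynomial.coeff μ (perPoly (Fin n) ℂ)) * MvPolynomial.X none ^ m)) :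
    HasNSRefutationOfDegree (fun μ : (Fin n × Fin n) →₀ ℕ => ((Matrix.of fun i j : Fin m => MvPolynomial.C (MvPolynomial.X (none, (i, j))) + ∑ e : Fin n × Fin n, MvPolynomial.X e * MvPolynomial.C (MvPolynomial.X (some e, (i, j))) : Matrix (Fin m) (Fin m) (MvPolynomial (Fin n × Fin n) (MvPolynomial (Option (Fin n × Fin n) × (Fin m × Fin m)) ℂ))).det - MvPolynomial.map MvPolynomial.C (Literature.Computability.AlgebraicComplexity.perPoly (Fin n) ℂ)).coeff μ) ((Fintype.card (Option (Fin n × Fin n) × (Fin m × Fin m)) + 1) * (0 + m)) := by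
  sorry

/-- **Line `Sketch` v2: `GctThesis ⇒ CertWindowQP` modulo the Briançon–Skoda theorem
(`stub_brianconSkoda`)**, with `c' = 5`. For `c` take `n := max n₀ 1` with `n₀` from `GctThesis` at
`c`; for `m < n` use the landed `stub_nsSmall`; for `n ≤ m ≤ 2^((log₂ n + c)^c)` the padded permanent
is off the orbit closure, so `stub_pullback` + `stub_homogSelect` (with `stub_coeffHomog`) give a
homogeneous separating relation, `stub_integralRel` the integral equation of `T^m` over `(G_μ)`,
Briançon–Skoda the membership `T^{m(N+1)} ∈ (G_μ)`, `stub_nsOfPowMem` a Nullstellensatz refutation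
of degree `≤ (N+1)m ≤ (m+2)^5` (landed `stub_degArith`), hence a Hermitian-SOS refutation of that
degree, rewritten in the route's form by
`exists_sos_certificate_support_of_hasHermitianSosRefutationOfDegree_coeff` (landed). -/
theorem CertWindowQP_of (hG : GCTMult.GctThesis) : RefutationDegree.CertWindowQP := by
  classical
  refine ⟨5, fun c => ?_⟩
  obtain ⟨n₀, hn₀⟩ := hG c
  obtain ⟨n, hn₀n, h1n⟩ : ∃ n : ℕ, n₀ ≤ n ∧ 1 ≤ n := ⟨max n₀ 1, le_max_left _ _, le_max_right _ _⟩
  refine ⟨n, fun m hm =>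
    exists_sos_certificate_support_of_hasHermitianSosRefutationOfDegree_coeff _ ((m + 2) ^ 5) ?_⟩
  by_cases hlt : m < n
  · exact ((stub_nsSmall n m hlt).mono (Nat.zero_le _)).hasHermitianSosRefutationOfDegree
  · push Not at hlt
    haveI : NeZero m := ⟨by omega⟩
    have hpad := hn₀ n hn₀n m hlt hm
    have hhom := stub_coeffHomog n m
    obtain ⟨q, hq0, hqP⟩ := stub_pullback n m hlt hpad
    obtain ⟨i, F, hF, hF0, hFP⟩ := stub_homogSelect n m q hhom hq0 hqP
    obtain ⟨Φ, hΦ, hΦ0, hΦG⟩ := stub_integralRel n m i F hF hF0 hFP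
    have hmem := stub_brianconSkoda ℂ (Option (Option (Fin n × Fin n) × (Fin m × Fin m)))
      ((Fin n × Fin n) →₀ ℕ) _ _ i Φ hΦ hΦ0 hΦG
    have hns := stub_nsOfPowMem n m hhom hmem
    exact (hns.mono (by simpa using stub_degArith n m hlt)).hasHermitianSosRefutationOfDegree

end Summit.ValiantsHypothesis.ValiantsHypothesis.Theorems
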